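import Literature.RingTheory.CohomologyAnnihilator.AnnihilationOfCohomologyProofs
import Mathlib.RingTheory.RegularLocalRing.Polynomial
import Mathlib.RingTheory.LocalProperties.ProjectiveDimension
import Mathlib.RingTheory.KrullDimension.Field
import HarnessLib

/-!
# The cohomology annihilator of a regular ring; Hilbert's syzygy theorem (global dimension form)

Topic: `Literature/RingTheory/CohomologyAnnihilator`. Globalisation of `RegularLocalRing.lean`:
for a REGULAR ring `A` (all localisations at primes regular local rings, Mathlib's
`IsRegularRing`) of Krull dimension `≤ n`, every finitely generated module has projective
dimension `≤ n`, i.e. `caⁿ⁺¹(A) = A` ([IyengarTakahashi2014, Example 2.5]: "`gldim Λ ≤ d` iff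
`caᵈ⁺¹(Λ) = Z(Λ)`"); projective dimension is tested at the maximal ideals (Mathlib's
`hasProjectiveDimensionLE_iff_forall_maximalSpectrum`) and `A_𝔪` is regular local of dimension
`ht 𝔪 ≤ n` (Serre, `RegularLocalRing.lean` / `AnnihilationOfCohomologyProofs.lean`).

In particular — **Hilbert's syzygy theorem** in the form `gldim k[x₁, …, x_d] = d` — the
polynomial ring in `d` variables over a field has `caᵈ⁺¹ = (1)`
(`cohomologyAnnihilatorOfDegree_mvPolynomial_eq_top`; regularity of polynomial rings over regular
rings is Mathlib's `MvPolynomial.isRegularRing_of_isRegularRing`). This is the input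
"`A` is noetherian and of finite global dimension" of a (separable) Noether normalisation in
[IyengarTakahashi2014, §3 (Separable noether normalization), Proposition 3.4, Theorem 3.6].

## References

* S. B. Iyengar, R. Takahashi, *Annihilation of cohomology and strong generation of module
  categories*, IMRN 2016; arXiv:1404.1476 — Example 2.5, §3. [`IyengarTakahashi2014`]
-/

noncomputable section

open CategoryTheory CategoryTheory.Abelian IsLocalRing

universe u

namespace Literature.RingTheory.CohomologyAnnihilator

variable (A : Type u) [CommRing A]

/-- **A regular ring of Krull dimension `≤ n` has global dimension `≤ n`**, in the language of
the cohomology annihilator: `caⁿ⁺¹(A) = A`, i.e. `Extⁱ_A(M, N) = 0` for all finitely generated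
`M`, `N` and `i ≥ n + 1`. Proof: by [IyengarTakahashi2014, Example 2.5] it suffices that every
finitely generated `M` has projective dimension `≤ n`; this is tested at the maximal ideals `𝔪`,
where `A_𝔪` is a regular local ring of dimension `ht 𝔪 ≤ n`, so `Ext^{≥ n+1}_{A_𝔪} = 0` on
finitely generated modules (Serre). [cite: IyengarTakahashi2014, Example 2.5] -/
theorem cohomologyAnnihilatorOfDegree_eq_top_of_isRegularRing [IsRegularRing A] {n : ℕ}
    (hn : ringKrullDim A ≤ n) : cohomologyAnnihilatorOfDegree A (n + 1) = ⊤ := by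
  refine cohomologyAnnihilatorOfDegree_eq_top_of_hasProjectiveDimensionLT fun M hM => ?_
  haveI := hM
  change HasProjectiveDimensionLE M n
  rw [ModuleCat.hasProjectiveDimensionLE_iff_forall_maximalSpectrum]
  intro m
  haveI : Module.Finite (Localization.AtPrime m.asIdeal)
      (M.localizedModule m.asIdeal.primeCompl) :=
    Module.Finite.of_isLocalizedModule m.asIdeal.primeCompl
      (M.localizedModuleMkLinearMap m.asIdeal.primeCompl)
  have hht : m.asIdeal.height ≤ n := by
    have h := (Ideal.height_le_ringKrullDim_of_isPrime (I := m.asIdeal)).trans hn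
    exact_mod_cast h
  have htop : cohomologyAnnihilatorOfDegree (Localization.AtPrime m.asIdeal) (n + 1) = ⊤ := by
    rw [cohomologyAnnihilatorOfDegree_eq_top_iff]
    intro i hi M' N' hM' hN' e
    exact ext_eq_zero_of_isRegularLocalRing_localization m.asIdeal hht hi M' N' e
  exact hasProjectiveDimensionLT_of_cohomologyAnnihilatorOfDegree_eq_top htop _

/-- A regular ring of finite Krull dimension has `ca(A) = A`. [cite: IyengarTakahashi2014, Example 2.5] -/
theorem cohomologyAnnihilator_eq_top_of_isRegularRing [IsRegularRing A] [FiniteRingKrullDim A] :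
    cohomologyAnnihilator A = ⊤ := by
  obtain ⟨n, hn⟩ := Literature.AlgebraicGeometry.Resolution.ringKrullDim_eq_nat A
  exact cohomologyAnnihilator_eq_top_iff.mpr
    ⟨n + 1, cohomologyAnnihilatorOfDegree_eq_top_of_isRegularRing A hn.le⟩

/-- Over a regular ring of Krull dimension `≤ n`, `Extⁱ_A(M, N) = 0` for finitely generated `M`,
`N` and `i ≥ n + 1` (`gldim A ≤ dim A`). [cite: IyengarTakahashi2014, Example 2.5] -/
theorem ext_eq_zero_of_isRegularRing [IsRegularRing A] {n : ℕ} (hn : ringKrullDim A ≤ n) {i : ℕ}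
    (hi : n + 1 ≤ i) (M N : ModuleCat.{u} A) [Module.Finite A M] [Module.Finite A N]
    (e : Ext.{u} M N i) : e = 0 :=
  cohomologyAnnihilatorOfDegree_eq_top_iff.mp
    (cohomologyAnnihilatorOfDegree_eq_top_of_isRegularRing A hn) i hi M N ‹_› ‹_› e

/-- A field is a regular ring. [folklore] -/
theorem isRegularRing_of_field (k : Type u) [Field k] : IsRegularRing k := inferInstance

/-- **Hilbert's syzygy theorem** (global dimension form): the polynomial ring `k[x₁, …, x_d]`
over a field has `caᵈ⁺¹ = (1)`, i.e. `Extⁱ(M, N) = 0` for all finitely generated modules and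
`i ≥ d + 1` — every finitely generated module has projective dimension `≤ d`. (Polynomial rings
over regular rings are regular, Mathlib's `MvPolynomial.isRegularRing_of_isRegularRing`, of Krull
dimension `d`.) [folklore] -/
theorem cohomologyAnnihilatorOfDegree_mvPolynomial_eq_top (k : Type u) [Field k] (d : ℕ) :
    cohomologyAnnihilatorOfDegree (MvPolynomial (Fin d) k) (d + 1) = ⊤ := by
  apply cohomologyAnnihilatorOfDegree_eq_top_of_isRegularRing
  rw [MvPolynomial.ringKrullDim_of_isNoetherianRing, ringKrullDim_eq_zero_of_field, zero_add,
    Nat.card_eq_fintype_card, Fintype.card_fin]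

/-- Hilbert's syzygy theorem, `Ext` form: over `k[x₁, …, x_d]`, `Extⁱ(M, N) = 0` for finitely
generated `M`, `N` and `i ≥ d + 1`. [folklore] -/
theorem ext_mvPolynomial_eq_zero (k : Type u) [Field k] (d : ℕ) {i : ℕ} (hi : d + 1 ≤ i)
    (M N : ModuleCat.{u} (MvPolynomial (Fin d) k)) [Module.Finite (MvPolynomial (Fin d) k) M]
    [Module.Finite (MvPolynomial (Fin d) k) N] (e : Ext.{u} M N i) : e = 0 :=
  cohomologyAnnihilatorOfDegree_eq_top_iff.mp
    (cohomologyAnnihilatorOfDegree_mvPolynomial_eq_top k d) i hi M N ‹_› ‹_› e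

end Literature.RingTheory.CohomologyAnnihilator

end
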